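import Summits.Ventures.HSemireg.WedgeHankelDual
import Summits.Ventures.HSemireg.WedgeWeilPurityLocus

/-!
# Venture HSemireg — THEOREM R-B in the mirror degrees n < m < 2n

HONEST FRAMING. Part of the Lean index of the computation cell `pub-hsemireg` (second enclosure wave, cut by seat p6 in the
conventions of seat p3's ENCLOSURE-PLAN-p3.md / build.py from th-7's kernel assets).  Finite-dimensional exterior algebra over a field ONLY:
no variety, no cohomology theory, no semiregularity map is constructed here; nothing here says that HC / HC_CM / HC_AV holds;
no Literature fact is declared or used.  The geometric DICTIONARY (why these ranks are the `HT`-side box ranks of the cell's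
STRUCTURE.md §1 / theory/FORMULA-N.md) lives in theory/FORMULA-N-th7.md PART B §A.3 / §N and is NOT asserted in Lean.

th-7's PART D, corollaries (theory/th7/WeilPurity.lean v3.2 sha256/16 fa4f1543e639b652 (th-7 g5, 22:21Z 2026-08-22; ×2 farm rc 0 + axioms standard at p3 g9 21:58Z (v3.1 prefix), th-2 g22 22:27Z, p6 g7 22:32Z; statement reads + independent exact numerics p6 g6 X2-WEILPURITY-p6g6.md a0873432c5a1b400 (PART W 105/105, PART D 704/704) and p6 g7 X2-WEILPURITY-E-p6g7.md 6348f244af71037e (PART E 216/216)), l.6935–6994), VERBATIM up to namespaces (as in `WedgeWeilPurityLocus.lean`):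
`vW` / `vW1` of signature `(n,n)` are homogeneous of degree `2n` in `⋀(K^{4n})` (`vW_nn_mem_Hom`, `vW1_nn_mem_Hom`), so `finrank_range_wedge_dual`
(`WedgeHankelDual.lean`) transports THEOREM R-B `weilRank_nn_deg` (degrees `1 ≤ m' ≤ n − 1`) and the one-sided `weilRank_nn_one` to the MIRROR degrees
`m = 2n − m'`: **`weilRank_nn_deg_dual`**, `weilRank_two_deg_three` (n = 2, degree 3: rank 8 = the STEP-0 HT³ anchor), **`weilRank_nn_one_dual`**.
Imports `WedgeWeilPurityLocus.lean` only for `card_Dm_nn` / `card_Gm_nn`.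
-/

/-! ### PART D — corollary for THEOREM R-B's class: the MIRROR degrees `n < m < 2n` (th-7 g5).
`vW` of signature `(n,n)` is homogeneous of degree `2n` in `⋀(K^{4n})`, so `finrank_range_wedge_dual` transports
`weilRank_nn_deg` (degrees `1 ≤ m' ≤ n − 1`) to the degrees `m = 2n − m'`, i.e. `n + 1 ≤ m ≤ 2n − 1`. -/

namespace Summit.Ventures.HSemireg.Wedge.WeilPurity

open Module Summit.Ventures.HSemireg.Wedge.Weil
open Summit.Ventures.HSemireg.Wedge.Hankel hiding Φ isoQ Φ_ι

variable (K : Type*) [Field K] (n : ℕ)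

/-- the Weil vector of type `(n,n)` (`f + a·w₊ + b·w₋`) is homogeneous of degree `2n`. -/
lemma vW_nn_mem_Hom (q : ℕ → K) (a b : K) :
    vW K (n + n) n q a b ∈ Hom K (In (n + n)) Finset.univ (n + n) := by
  unfold vW
  refine Submodule.add_mem _ (Submodule.add_mem _ ?_ ?_) ?_
  · exact Hom_mono K (Finset.subset_univ _) _ (w_mem_Hom K le_rfl q)
  · exact Submodule.smul_mem _ _ (B_mem_Hom K (Finset.subset_univ _) (card_Gm_nn (n := n)))
  · exact Submodule.smul_mem _ _ (B_mem_Hom K (Finset.subset_univ _) (card_Dm_nn (n := n)))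

/-- **THEOREM R-B IN THE MIRROR DEGREES** (Weil type `(n,n)`, `a b ≠ 0`, any `q`, any field): for
`m + m' = 2n` with `1 ≤ m' ≤ n − 1` (equivalently `n + 1 ≤ m ≤ 2n − 1`),
`finrank range(θ ↦ θ ∧ vW ∣ ⋀^m) + (C(n,m') + C(n,m'))·ρ_{m'} = C(2n,m') + C(2n,m') + C(2n,m')·ρ_{m'}`,
`ρ_{m'} = rank H_{m'}(q)` — the degree-`m'` value of `weilRank_nn_deg`, by `finrank_range_wedge_dual`. -/
theorem weilRank_nn_deg_dual {m m' : ℕ} (hm1 : 1 ≤ m') (hmn : m' + 1 ≤ n) (hmm : m + m' = n + n)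
    (q : ℕ → K) {a b : K} (ha : a ≠ 0) (hb : b ≠ 0) :
    Module.finrank K (LinearMap.range (wedge K (n + n) m (vW K (n + n) n q a b))) +
        (n.choose m' + n.choose m') * (hankel1 K (n + n) m' q).rank =
      (n + n).choose m' + (n + n).choose m' + (n + n).choose m' * (hankel1 K (n + n) m' q).rank := by
  rw [finrank_range_wedge_dual K (n := n + n) (d := n + n) (m := m) (m' := m') (by omega)
    (vW_nn_mem_Hom K n q a b)]
  exact weilRank_nn_deg K hm1 hmn q ha hb

/-- `n = 2`, degree `3` (the one mirror degree at `n = 2`): `finrank + 4ρ₁ = 8 + 4ρ₁`, i.e. rank `8`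
(PART B §F: HT³ column at n = 2 reads 8 = HT¹). -/
theorem weilRank_two_deg_three (q : ℕ → K) {a b : K} (ha : a ≠ 0) (hb : b ≠ 0) :
    Module.finrank K (LinearMap.range (wedge K (2 + 2) 3 (vW K (2 + 2) 2 q a b))) = 8 := by
  have h := weilRank_nn_deg_dual K 2 (m := 3) (m' := 1) le_rfl le_rfl rfl q ha hb
  norm_num [Nat.choose] at h
  omega

/-- the one-sided (n,n) Weil vector `f + a·w₊` is homogeneous of degree `2n` as well -/
lemma vW1_nn_mem_Hom (q : ℕ → K) (a : K) :
    vW1 K (n + n) n q a ∈ Hom K (In (n + n)) Finset.univ (n + n) := by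
  unfold vW1
  refine Submodule.add_mem _ ?_ ?_
  · exact Hom_mono K (Finset.subset_univ _) _ (w_mem_Hom K le_rfl q)
  · exact Submodule.smul_mem _ _ (B_mem_Hom K (Finset.subset_univ _) (card_Gm_nn (n := n)))

/-- **ONE-SIDED THEOREM R (ε = 1) IN THE MIRROR DEGREES** (`v = f + a·w₊`, type `(n,n)`, `a ≠ 0`, any `q`):
for `m + m' = 2n`, `m' + 1 ≤ n`: `finrank range(θ ↦ θ ∧ v ∣ ⋀^m) + C(n,m')·ρ_{m'} = C(2n,m') + C(2n,m')·ρ_{m'}`. -/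
theorem weilRank_nn_one_dual {m m' : ℕ} (hmn : m' + 1 ≤ n) (hmm : m + m' = n + n)
    (q : ℕ → K) {a : K} (ha : a ≠ 0) :
    Module.finrank K (LinearMap.range (wedge K (n + n) m (vW1 K (n + n) n q a))) +
        n.choose m' * (hankel1 K (n + n) m' q).rank =
      (n + n).choose m' + (n + n).choose m' * (hankel1 K (n + n) m' q).rank := by
  rw [finrank_range_wedge_dual K (n := n + n) (d := n + n) (m := m) (m' := m') (by omega)
    (vW1_nn_mem_Hom K n q a)]
  exact weilRank_nn_one K hmn q ha

end Summit.Ventures.HSemireg.Wedge.WeilPurity
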